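import Literature.MathematicalPhysics.QuantumFieldTheory.Balaban1983to89.B13Lemma3TorusPrimitive

/-!
# `Balaban1983to89.B13CovarianceDifference216` — T. Bałaban, *Renormalization group approach to lattice gauge field
theories. II. Cluster expansions*, Commun. Math. Phys. **116** (1988) 1–22 [Balaban1988RG2Cluster], pp. 15–16: of the
seven PRIMITIVE kernel hypotheses of the torus-model capstone `B13Lemma3TorusPrimitive.h226_torus_of_primitives`
(`hG hΓ₀ hCs hC216` — uniform localisation, cell locus L17a; `hdΓ hdC hdE` — the (2.16)-type bounds of the
σ-differences, cell locus L16a), the covariance-difference bound `hdC` (`C^{(k)}(Z₀,σ) − C^{(k)}(Z₀,0)`, i.e.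
`A(σ)⁻¹ − C`) is NOT primitive: by the resolvent identity `A(σ)⁻¹ − C = −A(σ)⁻¹·(A(σ) − C⁻¹)·C` it FOLLOWS from the
precision-difference bound `hdE` and the uniform localisation `hCs`, `hC216`, at a twice-dropped rate and with the
lattice constant of the torus (`hdC_of_hdE`); symmetrically `hdE` follows from `hdC` and uniform bounds on the
precisions (`hdE_of_hdC`).  Plus: the entries of the inverse of a kernel family differentiable in the configuration are
differentiable where the determinant does not vanish (`differentiableOn_matrix_inv`) — the analyticity half of the
covariance's p. 15 input is free given that of the precision.

statement-level skeleton of published theorems with citation tags; proofs where landed; nothing here is a claim about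
the Yang–Mills mass gap

PDF held: `paper:balaban1988-cmp116-rg-ii-cluster` (journal page = PDF page + 0); pp. 15–16 as quoted in
`B13Bound226Located` ∕ `B13Lemma3TorusPrimitive` ∕ `B13Eq216AnalyticStep` (materialised `p0015.txt`, `p0016.txt` there).

CITATION HEADER (verbatim, p. 15 [PDF 15] – p. 16 [PDF 16]): *"The quadratic forms and covariances in H(Z) are analytic
functions on the space of configurations (U, J) satisfying the conditions I.(i)–(iii) on the domain Z … For the pair
(U, 0) the operators are symmetric, and the measure is positive, and then the estimates are simpler. The general case is
handled by a perturbative argument. … In the expression on the right-hand side we replace the operators by the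
corresponding operators with σ(Z) = 0, 𝐔 = U, 𝐉 = 0, and we estimate the error. For the quadratic form in the first
exponential the difference is a quadratic form ½⟨X, R₁X⟩, with matrix elements satisfying the bound*
`|R₁(b, b′)| ≦ (O(1)e^{−⅓δ₀M} + O(α₀ + α₁)) exp(−½δ₀|b₋ − b′₋|).`  (2.16)".

WHAT IS REPRODUCED (cell `pub-balaban-gaps`, YM BLITZ track G1, prover seat g1-p2 gen 2, binder (D4) of B12 Thm 2's
perturbative road; NODE A.4 = the FIRST MISSING ESTIMATE (T3) of `HOME/g1/G1-PLAN-D4.md` §6 (L1″), sharpened — a NEW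
LEAF, nothing in the tree edited; every located-kernel step is a theorem of `B13Bound226Located` by name):
* §1 (arbitrary located index geometry `S, ρ, Kc` of `B13Bound226Located`) `inv_sub_inv_entry_le` — if `A⁻¹`, `B⁻¹`
  are entrywise `≤ K·e^{−κρ}` and `B − A` is `≤ θ·e^{−κρ}` (the same index set located with `≤ m` indices per site),
  then `A⁻¹ − B⁻¹ = A⁻¹(B − A)B⁻¹` (`Matrix.inv_sub_inv`, valid whenever `A` is a unit iff `B` is) is
  `≤ K_A·θ·K_B·(mKc(κ−κ′))(mKc(κ′−κ″))·e^{−κ″ρ}` for `κ > κ′ > κ″ ≥ 0` (`entry_mul_le` twice); `sub_entry_le_of_inv` —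
  the same read backwards for two units (`A − B = A(B⁻¹ − A⁻¹)B`); `mul_sub_mul_entry_le` — the difference of two
  PRODUCTS of located kernels from the differences of the factors (`PQ − P′Q′ = P(Q − Q′) + (P − P′)Q′`), for the
  composite Γ-kernel.
* §2 the papers' carrier (bonds located on the site torus `UT Nf`, ℓ¹ torus distance `tdist1`, lattice constant
  `(1 + 2/b)^ν` — the instance data `weightHyp_tdist1`, `kc_tdist1` of `B13Lemma3TorusPrimitive`):
  `inv_sub_inv_entry_le_torus`.
* §3 (calculus, any nontrivially normed field `𝕜`, any normed domain space) `differentiableOn_matrix_det`,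
  `…_adjugate`, `differentiableOn_matrix_inv`: entries differentiable on a set ⟹ determinant, adjugate and — where
  `det ≠ 0` — the entries of the inverse are differentiable there (Leibniz expansion; `A⁻¹ = (det A)⁻¹·adj A`); the
  `DifferentiableOn` twin of `Literature.Analysis.Calculus.ContDiffOn.matrix_inv`, in the currency of
  `B13Eq216AnalyticStep` (`DifferentiableOn ℂ … (ball 0 R)`).
* §4 THE HYPOTHESIS SHAPES OF `h226_torus_of_primitives` (σ on the polydisc `‖σ_j‖ ≤ e^{κ₁}`, `A(σ)` complex symmetric
  with `Re A(σ) ≻ 0` — hence a unit, `B13FirstEstimate215.cgaussNorm_ne_zero` —, reference covariance `C ≻ 0` real):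
  **`hdC_of_hdE`** — `hCs` (rate κ, constant `K_Cs`) ∧ `hC216` (`K₀`) ∧ `hdE` (`θ_E`) ⟹ `hdC` at rate `κ″` with
  `θ_C = K_Cs·θ_E·(m(1+2/(κ−κ′))^ν)·K₀·(m(1+2/(κ′−κ″))^ν)`; **`hdE_of_hdC`** — uniform precision bounds (`K_E`, `K_E₀`
  for `A(σ)`, `C⁻¹`) ∧ `hdC` (`θ_C`) ⟹ `hdE` at rate `κ″`.  CONSEQUENCE FOR (D4)'s first missing lemma ((T3a) of the
  cell plan: the three σ-part bounds `θ_σ,Γ, θ_σ,C, θ_σ,E` of print's «O(1)e^{−⅓δ₀M}», asserted at (2.16), no printed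
  derivation in the series): given the uniform localisation L17a (itself the [13] = CMP 99 Thm 3.15-type input, cell
  GAPS G-B9-10), only TWO of the three are independent — the Γ-kernel's and ONE of {precision, covariance}; and of
  (T3b)'s three analyticity clauses the covariance's is implied by the precision's (§3).  The rate drop κ → κ″ is
  absorbed downstream by the antitonicity of every consumer in the rate (`B13Bound226Located.entry_bound_mono_rate`).
HONEST SCOPE.  Elementary located-kernel algebra and calculus over theorems already in the tree; no operator of
[13]∕[15] is constructed, no random walk expansion is performed, NO bound of Bałaban's is proved: the uniform
localisation (`K_Cs`, `K₀`, `K_E`) and one σ-part (`θ_E` or `θ_C`) REMAIN hypotheses, and nothing of cell GAPS G-B9-10 ∕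
G-B13-09 is resolved.  No `sorry`, no definition, no new named fact (D-0026).  NOT B12 Thm 2, NOT `BetaPertH`, NOT
continuum∕ℝ⁴, NOT Clay.
-/

noncomputable section

namespace Literature.MathematicalPhysics.QuantumFieldTheory.Balaban1983to89.B13CovarianceDifference216

open Complex Metric Finset Matrix
open B13PerturbativeStep (WeightHyp)
open B13Bound226Located (entry_mul_le entry_bound_mono_rate Kc_nonneg)
open B9Thm37GlueTorus (tdist1 tdist1_nonneg)
open B5TorusCover (UT)
open B13Lemma3TorusPrimitive (weightHyp_tdist1 kc_tdist1)
open B13FirstEstimate215 (cgaussNorm_ne_zero)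

/-! ## §1. Located index geometry: the (2.16)-type bound for a difference of INVERSES from the difference of the
kernels and the uniform localisation of the inverses (resolvent identity) -/

section Located

variable {S : Type*} [DecidableEq S] {ρ : S → S → ℝ} {Kc : ℝ → ℝ}
variable {Λ : Type*} [Fintype Λ] [DecidableEq Λ] {𝕜 : Type*} [RCLike 𝕜]

/-- **The (2.16)-type bound for a DIFFERENCE OF INVERSES from the difference of the kernels** (arbitrary located
index geometry): if `A` is a unit iff `B` is, `‖A⁻¹(i,j)‖ ≤ K_A e^{−κρ(loc i, loc j)}`, `‖B⁻¹(i,j)‖ ≤ K_B e^{−κρ}`,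
`‖(B − A)(i,j)‖ ≤ θ e^{−κρ}`, the index set located with `≤ m` indices per site, then for `κ > κ′ > κ″ ≥ 0`
`‖(A⁻¹ − B⁻¹)(i,j)‖ ≤ K_A·θ·mKc(κ−κ′)·K_B·mKc(κ′−κ″)·e^{−κ″ρ(loc i, loc j)}` — the resolvent identity
`A⁻¹ − B⁻¹ = A⁻¹(B − A)B⁻¹` (`Matrix.inv_sub_inv`) and two located compositions (`B13Bound226Located.entry_mul_le`).
This is the step *"we replace the operators by the corresponding operators with σ(Z) = 0 … and we estimate the error"*
for the covariance `C^{(k)}(Z₀,σ) = A(σ)⁻¹` given the error of the precision. [folklore]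
[cite: Balaban1988RG2Cluster, (2.16) p.16] -/
theorem inv_sub_inv_entry_le (hρ : WeightHyp 0 ρ)
    (hKc : ∀ b : ℝ, 0 < b → ∀ (T : Finset S) (x : S), ∑ y ∈ T, Real.exp (-(b * ρ x y)) ≤ Kc b)
    {A B : Matrix Λ Λ 𝕜} (hAB : IsUnit A ↔ IsUnit B) {KA KB θ κ κ' κ'' : ℝ} (hKA : 0 ≤ KA) (hKB : 0 ≤ KB)
    (hθ : 0 ≤ θ) (hκ'' : 0 ≤ κ'') (h1 : κ'' < κ') (h2 : κ' < κ) (loc : Λ → S) {m : ℕ}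
    (hfib : ∀ x : S, (Finset.univ.filter fun j => loc j = x).card ≤ m)
    (hA : ∀ i j, ‖A⁻¹ i j‖ ≤ KA * Real.exp (-(κ * ρ (loc i) (loc j))))
    (hB : ∀ i j, ‖B⁻¹ i j‖ ≤ KB * Real.exp (-(κ * ρ (loc i) (loc j))))
    (hE : ∀ i j, ‖(B - A) i j‖ ≤ θ * Real.exp (-(κ * ρ (loc i) (loc j)))) (i j : Λ) :
    ‖(A⁻¹ - B⁻¹) i j‖ ≤ KA * θ * (m * Kc (κ - κ')) * KB * (m * Kc (κ' - κ''))
      * Real.exp (-(κ'' * ρ (loc i) (loc j))) := by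
  have hκ' : 0 ≤ κ' := hκ''.trans h1.le
  rw [Matrix.inv_sub_inv hAB]
  -- first composition: A⁻¹ (B − A) at rate κ′
  have h12 : ∀ i l, ‖(A⁻¹ * (B - A)) i l‖ ≤ KA * θ * (m * Kc (κ - κ'))
      * Real.exp (-(κ' * ρ (loc i) (loc l))) :=
    entry_mul_le hρ hKc hKA hθ hκ' h2 loc loc loc hfib hA hE
  -- second composition with B⁻¹ weakened to rate κ′
  have hB' : ∀ l j, ‖B⁻¹ l j‖ ≤ KB * Real.exp (-(κ' * ρ (loc l) (loc j))) :=
    entry_bound_mono_rate hρ hKB h2.le loc loc hB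
  have hK1 : 0 ≤ KA * θ * (m * Kc (κ - κ')) :=
    mul_nonneg (mul_nonneg hKA hθ) (mul_nonneg (Nat.cast_nonneg m) (Kc_nonneg hKc (sub_pos.2 h2) (loc i)))
  exact entry_mul_le hρ hKc hK1 hKB hκ'' h1 loc loc loc hfib h12 hB' i j

/-- **… and backwards**: for two units `A`, `B` located as above, `‖A(i,j)‖ ≤ K_A e^{−κρ}`, `‖B(i,j)‖ ≤ K_B e^{−κρ}` and
`‖(B⁻¹ − A⁻¹)(i,j)‖ ≤ θ e^{−κρ}` give `‖(A − B)(i,j)‖ ≤ K_A·θ·mKc(κ−κ′)·K_B·mKc(κ′−κ″)·e^{−κ″ρ}`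
(`A − B = A(B⁻¹ − A⁻¹)B`, i.e. `inv_sub_inv_entry_le` applied to `A⁻¹`, `B⁻¹` with `(A⁻¹)⁻¹ = A`). [folklore]
[cite: Balaban1988RG2Cluster, (2.16) p.16] -/
theorem sub_entry_le_of_inv (hρ : WeightHyp 0 ρ)
    (hKc : ∀ b : ℝ, 0 < b → ∀ (T : Finset S) (x : S), ∑ y ∈ T, Real.exp (-(b * ρ x y)) ≤ Kc b)
    {A B : Matrix Λ Λ 𝕜} (hAu : IsUnit A.det) (hBu : IsUnit B.det) {KA KB θ κ κ' κ'' : ℝ} (hKA : 0 ≤ KA)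
    (hKB : 0 ≤ KB) (hθ : 0 ≤ θ) (hκ'' : 0 ≤ κ'') (h1 : κ'' < κ') (h2 : κ' < κ) (loc : Λ → S) {m : ℕ}
    (hfib : ∀ x : S, (Finset.univ.filter fun j => loc j = x).card ≤ m)
    (hA : ∀ i j, ‖A i j‖ ≤ KA * Real.exp (-(κ * ρ (loc i) (loc j))))
    (hB : ∀ i j, ‖B i j‖ ≤ KB * Real.exp (-(κ * ρ (loc i) (loc j))))
    (hD : ∀ i j, ‖(B⁻¹ - A⁻¹) i j‖ ≤ θ * Real.exp (-(κ * ρ (loc i) (loc j)))) (i j : Λ) :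
    ‖(A - B) i j‖ ≤ KA * θ * (m * Kc (κ - κ')) * KB * (m * Kc (κ' - κ''))
      * Real.exp (-(κ'' * ρ (loc i) (loc j))) := by
  have hAB : IsUnit A⁻¹ ↔ IsUnit B⁻¹ := by
    rw [Matrix.isUnit_nonsing_inv_iff, Matrix.isUnit_nonsing_inv_iff, Matrix.isUnit_iff_isUnit_det,
      Matrix.isUnit_iff_isUnit_det]
    exact ⟨fun _ => hBu, fun _ => hAu⟩
  have key := inv_sub_inv_entry_le (A := A⁻¹) (B := B⁻¹) hρ hKc hAB hKA hKB hθ hκ'' h1 h2 loc hfib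
    (by rw [Matrix.nonsing_inv_nonsing_inv A hAu]; exact hA)
    (by rw [Matrix.nonsing_inv_nonsing_inv B hBu]; exact hB) hD i j
  rwa [Matrix.nonsing_inv_nonsing_inv A hAu, Matrix.nonsing_inv_nonsing_inv B hBu] at key


omit [DecidableEq Λ] in
/-- **The (2.16)-type bound for a difference of PRODUCTS of located kernels** (for the Γ-kernel, a composite of primitive
operators — `Γ_k(Z₀,σ) = C*Δ(σ)C_{Z₀ᶜ}(C^{(k)})^{1/2}(σ)`, p. 15): `PQ − P′Q′ = P(Q − Q′) + (P − P′)Q′`, so uniform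
localisation of `P`, `Q′` (`K_P`, `K_Q`) and the difference bounds `θ_P`, `θ_Q` at rate `κ` give
`‖(PQ − P′Q′)(i,k)‖ ≤ (K_P·θ_Q + θ_P·K_Q)·mKc(κ−κ′)·e^{−κ′ρ}` (`entry_mul_le` twice): the σ-difference bound of a
composite kernel REDUCES to those of its factors. [folklore] [cite: Balaban1988RG2Cluster, (2.16) p.16, p.15] -/
theorem mul_sub_mul_entry_le {p q : Type*} (hρ : WeightHyp 0 ρ)
    (hKc : ∀ b : ℝ, 0 < b → ∀ (T : Finset S) (x : S), ∑ y ∈ T, Real.exp (-(b * ρ x y)) ≤ Kc b)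
    {P P' : Matrix p Λ 𝕜} {Q Q' : Matrix Λ q 𝕜} {KP KQ θP θQ κ κ' : ℝ} (hKP : 0 ≤ KP) (hKQ : 0 ≤ KQ)
    (hθP : 0 ≤ θP) (hθQ : 0 ≤ θQ) (hκ' : 0 ≤ κ') (hlt : κ' < κ) (locp : p → S) (loc : Λ → S) (locq : q → S)
    {m : ℕ} (hfib : ∀ x : S, (Finset.univ.filter fun j => loc j = x).card ≤ m)
    (hP : ∀ i j, ‖P i j‖ ≤ KP * Real.exp (-(κ * ρ (locp i) (loc j))))
    (hQ' : ∀ j k, ‖Q' j k‖ ≤ KQ * Real.exp (-(κ * ρ (loc j) (locq k))))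
    (hdP : ∀ i j, ‖(P - P') i j‖ ≤ θP * Real.exp (-(κ * ρ (locp i) (loc j))))
    (hdQ : ∀ j k, ‖(Q - Q') j k‖ ≤ θQ * Real.exp (-(κ * ρ (loc j) (locq k)))) (i : p) (k : q) :
    ‖(P * Q - P' * Q') i k‖ ≤ (KP * θQ + θP * KQ) * (m * Kc (κ - κ')) * Real.exp (-(κ' * ρ (locp i) (locq k))) := by
  have hsplit : P * Q - P' * Q' = P * (Q - Q') + (P - P') * Q' := by
    rw [Matrix.mul_sub, Matrix.sub_mul]; abel
  have h1 := entry_mul_le hρ hKc hKP hθQ hκ' hlt locp loc locq hfib hP hdQ i k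
  have h2 := entry_mul_le hρ hKc hθP hKQ hκ' hlt locp loc locq hfib hdP hQ' i k
  rw [hsplit, Matrix.add_apply]
  refine (norm_add_le _ _).trans ((add_le_add h1 h2).trans (le_of_eq ?_))
  ring

end Located

/-! ## §2. The papers' carrier: bonds located on the site torus `UT Nf`, ℓ¹ torus distance -/

section Torus

variable {ν : ℕ} {Nf : Fin ν → ℕ} [∀ i, NeZero (Nf i)]
variable {Λ : Type*} [Fintype Λ] [DecidableEq Λ] {𝕜 : Type*} [RCLike 𝕜]

/-- **The papers' carrier**: `inv_sub_inv_entry_le` for bonds located on the site torus `UT Nf` with its ℓ¹ distance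
`tdist1` and lattice constant `(1 + 2/b)^ν` (`B13Lemma3TorusPrimitive.weightHyp_tdist1`, `kc_tdist1`) — the shape in
which `B13Lemma3TorusPrimitive.h226_torus_of_primitives` states its kernel hypotheses. [folklore]
[cite: Balaban1988RG2Cluster, (2.16) p.16] -/
theorem inv_sub_inv_entry_le_torus {A B : Matrix Λ Λ 𝕜} (hAB : IsUnit A ↔ IsUnit B)
    {KA KB θ κ κ' κ'' : ℝ} (hKA : 0 ≤ KA) (hKB : 0 ≤ KB) (hθ : 0 ≤ θ) (hκ'' : 0 ≤ κ'') (h1 : κ'' < κ')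
    (h2 : κ' < κ) (loc : Λ → UT Nf) {m : ℕ}
    (hfib : ∀ x : UT Nf, (Finset.univ.filter fun j => loc j = x).card ≤ m)
    (hA : ∀ i j, ‖A⁻¹ i j‖ ≤ KA * Real.exp (-(κ * tdist1 Nf (loc i) (loc j))))
    (hB : ∀ i j, ‖B⁻¹ i j‖ ≤ KB * Real.exp (-(κ * tdist1 Nf (loc i) (loc j))))
    (hE : ∀ i j, ‖(B - A) i j‖ ≤ θ * Real.exp (-(κ * tdist1 Nf (loc i) (loc j)))) (i j : Λ) :
    ‖(A⁻¹ - B⁻¹) i j‖ ≤ KA * θ * (m * (1 + 2 / (κ - κ')) ^ ν) * KB * (m * (1 + 2 / (κ' - κ'')) ^ ν)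
      * Real.exp (-(κ'' * tdist1 Nf (loc i) (loc j))) :=
  inv_sub_inv_entry_le (Kc := fun b : ℝ => (1 + 2 / b) ^ ν) weightHyp_tdist1 kc_tdist1 hAB hKA hKB hθ hκ'' h1
    h2 loc hfib hA hB hE i j

end Torus

/-! ## §3. Analyticity of the entries of the inverse from analyticity of the entries -/

section Analytic

variable {𝕜 : Type*} [NontriviallyNormedField 𝕜] {E : Type*} [NormedAddCommGroup E] [NormedSpace 𝕜 E]
variable {ι : Type*} [Fintype ι] [DecidableEq ι] {s : Set E}

/-- **The determinant of a matrix field with differentiable entries is differentiable** (Leibniz expansion; any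
normed domain space, any nontrivially normed field `𝕜`). [folklore] [cite: MagnusNeudecker2019, Ch. 8] -/
theorem differentiableOn_matrix_det {A : E → Matrix ι ι 𝕜}
    (hA : ∀ i j, DifferentiableOn 𝕜 (fun y => A y i j) s) :
    DifferentiableOn 𝕜 (fun y => (A y).det) s := by
  have heq : (fun y => (A y).det) =
      fun y => ∑ σ : Equiv.Perm ι, ((Equiv.Perm.sign σ : ℤ) : 𝕜) * ∏ i, A y (σ i) i := by
    funext y
    rw [Matrix.det_apply]
    refine Finset.sum_congr rfl fun σ _ => ?_
    rw [Units.smul_def, zsmul_eq_mul]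
  rw [heq]
  refine DifferentiableOn.fun_sum fun σ _ => ?_
  refine DifferentiableOn.mul (differentiableOn_const _) ?_
  intro x hx
  exact (HasFDerivWithinAt.finsetProd (u := (Finset.univ : Finset ι)) (g := fun i y => A y (σ i) i)
    fun i _ => ((hA (σ i) i) x hx).hasFDerivWithinAt).differentiableWithinAt

/-- **The adjugate of a matrix field with differentiable entries has differentiable entries**
(`adj A i j = det (A with row j replaced by eᵢ)`). [folklore] [cite: MagnusNeudecker2019, Ch. 8] -/
theorem differentiableOn_matrix_adjugate {A : E → Matrix ι ι 𝕜}
    (hA : ∀ i j, DifferentiableOn 𝕜 (fun y => A y i j) s) (i j : ι) :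
    DifferentiableOn 𝕜 (fun y => (A y).adjugate i j) s := by
  simp only [Matrix.adjugate_apply]
  refine differentiableOn_matrix_det (A := fun y => (A y).updateRow j (Pi.single i 1)) fun a c => ?_
  by_cases h : a = j
  · subst h
    simp only [Matrix.updateRow_self]
    exact differentiableOn_const _
  · simp only [Matrix.updateRow_ne h]
    exact hA a c

/-- **The entries of the inverse of a matrix field with differentiable entries are differentiable where the
determinant does not vanish** (`A⁻¹ = (det A)⁻¹ • adj A`) — for the (2.14)-term: the covariance `C^{(k)}(Z₀,σ,𝐔,𝐉) =
A(σ,𝐔,𝐉)⁻¹` is analytic in the configuration wherever the precision is analytic and invertible (p. 15: *"The quadratic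
forms and covariances in H(Z) are analytic functions on the space of configurations (U, J) …"*), so of the two
analyticity clauses of `B13Eq216AnalyticStep` for precision and covariance only the first is an input. [folklore]
[cite: MagnusNeudecker2019, Ch. 8] -/
theorem differentiableOn_matrix_inv {A : E → Matrix ι ι 𝕜}
    (hA : ∀ i j, DifferentiableOn 𝕜 (fun y => A y i j) s) (hdet : ∀ y ∈ s, (A y).det ≠ 0) (i j : ι) :
    DifferentiableOn 𝕜 (fun y => (A y)⁻¹ i j) s := by
  have heq : ∀ y ∈ s, (A y)⁻¹ i j = ((A y).det)⁻¹ * (A y).adjugate i j := by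
    intro y _
    rw [Matrix.inv_def, Ring.inverse_eq_inv', Matrix.smul_apply, smul_eq_mul]
  refine DifferentiableOn.congr ?_ heq
  exact ((differentiableOn_matrix_det hA).inv hdet).mul (differentiableOn_matrix_adjugate hA i j)

end Analytic

/-! ## §4. The torus model's hypothesis shapes: `hdC` from `hdE` (and the σ-part of the covariance difference from
that of the precision), uniformly on the σ-polydisc -/

section Model

variable {ν : ℕ} {Nf : Fin ν → ℕ} [∀ i, NeZero (Nf i)]
variable {Λ : Type} [Fintype Λ] [DecidableEq Λ] {ι : Type*}

/-- The complexification of a positive definite real kernel: `(C⁻¹ ↦ ℂ)⁻¹ = (C ↦ ℂ)` and `C⁻¹ ↦ ℂ` is a unit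
(as in `B13Replacement223.h17a_of_WRS`). [folklore] -/
private theorem inv_map_inv_of_posDef {C : Matrix Λ Λ ℝ} (hC : C.PosDef) :
    (C⁻¹.map (algebraMap ℝ ℂ))⁻¹ = C.map (algebraMap ℝ ℂ) ∧ IsUnit (C⁻¹.map (algebraMap ℝ ℂ)) := by
  have hCu : IsUnit C.det := hC.det_pos.ne'.isUnit
  have hmul : C⁻¹.map (algebraMap ℝ ℂ) * C.map (algebraMap ℝ ℂ) = 1 := by
    rw [← Matrix.map_mul, Matrix.nonsing_inv_mul C hCu, Matrix.map_one _ (map_zero _) (map_one _)]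
  exact ⟨Matrix.inv_eq_right_inv hmul,
    (Matrix.isUnit_iff_isUnit_det _).2 (Matrix.isUnit_det_of_right_inverse hmul)⟩

/-- A complex symmetric kernel with positive definite real part is a unit (`B13FirstEstimate215.cgaussNorm_ne_zero`).
[folklore] -/
private theorem isUnit_of_re_posDef {A : Matrix Λ Λ ℂ} (hAs : A.IsSymm) (hA : (A.map Complex.re).PosDef) :
    IsUnit A :=
  (Matrix.isUnit_iff_isUnit_det _).2 (isUnit_iff_ne_zero.2 (cgaussNorm_ne_zero hAs hA).2)

/-- **`hdC` from `hdE`** — in the hypothesis shapes of `B13Lemma3TorusPrimitive.h226_torus_of_primitives`: a kernel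
family `A(σ)` on the σ-polydisc `‖σ_j‖ ≤ e^{κ₁}`, complex symmetric with `Re A(σ) ≻ 0` (`hAs`, `hA`; hence each `A(σ)`
is a unit, `B13FirstEstimate215.cgaussNorm_ne_zero`), a real reference covariance `C ≻ 0` (`hC`); IF the covariances
`A(σ)⁻¹` are uniformly localised at rate `κ` with constant `K_Cs` (`hCs`, L17a), `C` with `K₀` (`hC216`, L17a), and the
PRECISION difference `A(σ) − C⁻¹` obeys the (2.16) shape with `θ_E` (`hdE`, L16a), THEN the COVARIANCE difference
`A(σ)⁻¹ − C` obeys the (2.16) shape at any rate `κ″ < κ′ < κ` with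
`θ_C = K_Cs·θ_E·(m(1+2/(κ−κ′))^ν)·K₀·(m(1+2/(κ′−κ″))^ν)` — the binder `hdC` of the capstone is a CONSEQUENCE of
`hCs ∧ hC216 ∧ hdE` (and of `hAs`, `hA`, `hC`, which the capstone takes anyway).  Print: (2.16) for `R₁`, whose
covariance part is this difference (`B13Eq216FirstForm.h216R1_of_factors`, factor `θ_C`).
[cite: Balaban1988RG2Cluster, (2.16) p.16] -/
theorem hdC_of_hdE (κ₁ : ℝ) (A : (ι → ℂ) → Matrix Λ Λ ℂ) {C : Matrix Λ Λ ℝ} (hC : C.PosDef)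
    (hAs : ∀ σ : ι → ℂ, (∀ j, ‖σ j‖ ≤ Real.exp κ₁) → (A σ).IsSymm)
    (hA : ∀ σ : ι → ℂ, (∀ j, ‖σ j‖ ≤ Real.exp κ₁) → ((A σ).map Complex.re).PosDef)
    (locΛ : Λ → UT Nf) {m : ℕ} (hfib : ∀ x : UT Nf, (Finset.univ.filter fun b => locΛ b = x).card ≤ m)
    {kap kap' kap'' KCs K₀ θE : ℝ} (hkap'' : 0 ≤ kap'') (h1 : kap'' < kap') (h2 : kap' < kap)
    (hKCs : 0 ≤ KCs) (hK₀ : 0 ≤ K₀) (hθE : 0 ≤ θE)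
    (hCs : ∀ σ : ι → ℂ, (∀ j, ‖σ j‖ ≤ Real.exp κ₁) →
      ∀ b b', ‖(A σ)⁻¹ b b'‖ ≤ KCs * Real.exp (-(kap * tdist1 Nf (locΛ b) (locΛ b'))))
    (hC216 : ∀ b b', ‖C b b'‖ ≤ K₀ * Real.exp (-(kap * tdist1 Nf (locΛ b) (locΛ b'))))
    (hdE : ∀ σ : ι → ℂ, (∀ j, ‖σ j‖ ≤ Real.exp κ₁) →
      ∀ b b', ‖(A σ - C⁻¹.map (algebraMap ℝ ℂ)) b b'‖ ≤ θE * Real.exp (-(kap * tdist1 Nf (locΛ b) (locΛ b')))) :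
    ∀ σ : ι → ℂ, (∀ j, ‖σ j‖ ≤ Real.exp κ₁) →
      ∀ b b', ‖((A σ)⁻¹ - C.map (algebraMap ℝ ℂ)) b b'‖ ≤
        KCs * θE * (m * (1 + 2 / (kap - kap')) ^ ν) * K₀ * (m * (1 + 2 / (kap' - kap'')) ^ ν)
          * Real.exp (-(kap'' * tdist1 Nf (locΛ b) (locΛ b'))) := by
  intro σ hσ b b'
  obtain ⟨hinv, hu₀⟩ := inv_map_inv_of_posDef hC
  have hAB : IsUnit (A σ) ↔ IsUnit (C⁻¹.map (algebraMap ℝ ℂ)) :=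
    ⟨fun _ => hu₀, fun _ => isUnit_of_re_posDef (hAs σ hσ) (hA σ hσ)⟩
  have hB : ∀ i j, ‖(C⁻¹.map (algebraMap ℝ ℂ))⁻¹ i j‖ ≤ K₀ * Real.exp (-(kap * tdist1 Nf (locΛ i) (locΛ j))) :=
    fun i j => by
      rw [hinv, Matrix.map_apply, Complex.coe_algebraMap, Complex.norm_real]
      exact hC216 i j
  have hE : ∀ i j, ‖(C⁻¹.map (algebraMap ℝ ℂ) - A σ) i j‖ ≤
      θE * Real.exp (-(kap * tdist1 Nf (locΛ i) (locΛ j))) := fun i j => by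
    rw [Matrix.sub_apply, norm_sub_rev, ← Matrix.sub_apply]
    exact hdE σ hσ i j
  have key := inv_sub_inv_entry_le_torus hAB hKCs hK₀ hθE hkap'' h1 h2 locΛ hfib (hCs σ hσ) hB hE b b'
  rwa [hinv] at key

/-- **`hdE` from `hdC`** (the same read backwards): IF the precisions `A(σ)` are uniformly bounded entrywise by
`K_E e^{−κd₁}` on the polydisc, the reference precision `C⁻¹` by `K_E₀ e^{−κd₁}`, and the covariance difference
`A(σ)⁻¹ − C` obeys (2.16) with `θ_C` (`hdC`), THEN the precision difference `A(σ) − C⁻¹` obeys (2.16) at rate `κ″` with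
`θ_E = K_E·θ_C·(m(1+2/(κ−κ′))^ν)·K_E₀·(m(1+2/(κ′−κ″))^ν)`.  So of the two σ-part inputs `θ_σ,C`, `θ_σ,E` of the cell's
(T3a) exactly ONE is independent given uniform localisation of covariances and precisions.
[cite: Balaban1988RG2Cluster, (2.16) p.16] -/
theorem hdE_of_hdC (κ₁ : ℝ) (A : (ι → ℂ) → Matrix Λ Λ ℂ) {C : Matrix Λ Λ ℝ} (hC : C.PosDef)
    (hAs : ∀ σ : ι → ℂ, (∀ j, ‖σ j‖ ≤ Real.exp κ₁) → (A σ).IsSymm)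
    (hA : ∀ σ : ι → ℂ, (∀ j, ‖σ j‖ ≤ Real.exp κ₁) → ((A σ).map Complex.re).PosDef)
    (locΛ : Λ → UT Nf) {m : ℕ} (hfib : ∀ x : UT Nf, (Finset.univ.filter fun b => locΛ b = x).card ≤ m)
    {kap kap' kap'' KE KE₀ θC : ℝ} (hkap'' : 0 ≤ kap'') (h1 : kap'' < kap') (h2 : kap' < kap)
    (hKE : 0 ≤ KE) (hKE₀ : 0 ≤ KE₀) (hθC : 0 ≤ θC)
    (hEσ : ∀ σ : ι → ℂ, (∀ j, ‖σ j‖ ≤ Real.exp κ₁) →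
      ∀ b b', ‖A σ b b'‖ ≤ KE * Real.exp (-(kap * tdist1 Nf (locΛ b) (locΛ b'))))
    (hE₀ : ∀ b b', ‖C⁻¹ b b'‖ ≤ KE₀ * Real.exp (-(kap * tdist1 Nf (locΛ b) (locΛ b'))))
    (hdC : ∀ σ : ι → ℂ, (∀ j, ‖σ j‖ ≤ Real.exp κ₁) →
      ∀ b b', ‖((A σ)⁻¹ - C.map (algebraMap ℝ ℂ)) b b'‖ ≤ θC * Real.exp (-(kap * tdist1 Nf (locΛ b) (locΛ b')))) :
    ∀ σ : ι → ℂ, (∀ j, ‖σ j‖ ≤ Real.exp κ₁) →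
      ∀ b b', ‖(A σ - C⁻¹.map (algebraMap ℝ ℂ)) b b'‖ ≤
        KE * θC * (m * (1 + 2 / (kap - kap')) ^ ν) * KE₀ * (m * (1 + 2 / (kap' - kap'')) ^ ν)
          * Real.exp (-(kap'' * tdist1 Nf (locΛ b) (locΛ b'))) := by
  intro σ hσ b b'
  obtain ⟨hinv, hu₀⟩ := inv_map_inv_of_posDef hC
  have hAu : IsUnit (A σ).det := (Matrix.isUnit_iff_isUnit_det _).1 (isUnit_of_re_posDef (hAs σ hσ) (hA σ hσ))
  have hBu : IsUnit (C⁻¹.map (algebraMap ℝ ℂ)).det := (Matrix.isUnit_iff_isUnit_det _).1 hu₀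
  have hB : ∀ i j, ‖(C⁻¹.map (algebraMap ℝ ℂ)) i j‖ ≤ KE₀ * Real.exp (-(kap * tdist1 Nf (locΛ i) (locΛ j))) :=
    fun i j => by
      rw [Matrix.map_apply, Complex.coe_algebraMap, Complex.norm_real]
      exact hE₀ i j
  have hD : ∀ i j, ‖((C⁻¹.map (algebraMap ℝ ℂ))⁻¹ - (A σ)⁻¹) i j‖ ≤
      θC * Real.exp (-(kap * tdist1 Nf (locΛ i) (locΛ j))) := fun i j => by
    rw [hinv, Matrix.sub_apply, norm_sub_rev, ← Matrix.sub_apply]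
    exact hdC σ hσ i j
  exact sub_entry_le_of_inv (Kc := fun b : ℝ => (1 + 2 / b) ^ ν) weightHyp_tdist1 kc_tdist1 hAu hBu hKE hKE₀
    hθC hkap'' h1 h2 locΛ hfib (hEσ σ hσ) hB hD b b'

end Model

end Literature.MathematicalPhysics.QuantumFieldTheory.Balaban1983to89.B13CovarianceDifference216

end
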